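import Literature.Analysis.UnboundedOperators.HeatKernelGaussianIBP
import Literature.Analysis.UnboundedOperators.HeatKernelRotationInvariance
import Mathlib.Analysis.Calculus.ParametricIntegral
import Mathlib.Analysis.Calculus.Deriv.MeanValue
import Mathlib.Analysis.SpecialFunctions.Trigonometric.Deriv
import HarnessLib

/-!
# The Gaussian Poincaré inequality for the heat-kernel measure

Analysis/UnboundedOperators file (all results proved, no definitions, no named facts). For a
finite-dimensional real inner product space `E`, `0 < t`, the Gauss–Weierstrass kernel
`G_t = heatKernel t` (a probability density with covariance `2t·Id`) and `f ∈ C¹(E)` with `f`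
and `Df` bounded:

`∫ f² G_t − (∫ f G_t)² ≤ 2t ∫ ‖Df‖² G_t`   (`sq_integral_heatKernel_poincare`),

the **Gaussian Poincaré inequality** with its sharp constant (the variance of `G_t(x)dx` in each
direction). For `t = 1` on `ℝ²`, `G_1 = G` is the Gaussian vortex profile of
`Analysis/FluidPDE/GaussianVortexPlanar`, and the inequality is the quadratic-form statement of
the spectral gap `−⟨Lw, w⟩_{L²(G⁻¹)} ≥ ½‖w‖²` of `L = Δ + ½x·∇ + 1` on mean-zero `w = Gh`
(Gallay–Wayne 2005/2006, App. A), the linear heart of the named facts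
`Literature.Analysis.FluidPDE.GallayWayne2006_thm11` / `GallayMaekawa2016_thm41`.

## Proof (Gaussian interpolation along rotations)

Let `X, Y` be independent with law `G_t` and `X_θ = cos θ X + sin θ Y`. Put
`F(θ) = E[f(X) f(X_θ)] = ∬ f(x) f(cos θ x + sin θ y) G_t(x)G_t(y)`, so `F(0) = ∫ f²G_t`,
`F(π/2) = (∫ fG_t)²`. Differentiating under the integral sign
(`hasDerivAt_integral_of_dominated_loc_of_deriv_le`, dominated by `‖f‖_∞‖Df‖_∞(‖x‖+‖y‖)G_tG_t`),
`F'(θ) = ∬ f(x) Df(X_θ)[−sin θ x + cos θ y] G_tG_t`. By the rotation invariance of `G_t ⊗ G_t`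
(`integral_comp_prodRotation_mul_heatKernel`) this equals `∬ f(cos θ u − sin θ v) Df(u)[v] G_tG_t`,
and Stein's identity in `v` (`integral_inner_mul_mul_heatKernel`) turns it into
`F'(θ) = −2t sin θ ∬ ⟪∇f(u), ∇f(cos θ u − sin θ v)⟫ G_tG_t ≥ −2t sin θ ∫‖Df‖²G_t`
(by `2ab ≤ a² + b²` and the Gaussian stability `cos θ U − sin θ V ∼ U`,
`integral_comp_prodRotation_fst_mul_heatKernel`). Hence `θ ↦ F(θ) − 2t cos θ ∫‖Df‖²G_t` is
monotone on `[0, π/2]` (`monotoneOn_of_hasDerivWithinAt_nonneg`), which is the claim.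

## References

* D. Bakry, I. Gentil, M. Ledoux, *Analysis and Geometry of Markov Diffusion Operators*,
  Springer 2014, Prop. 4.1.1 (Poincaré inequality for the Gaussian measure, constant = variance).
* Th. Gallay, C. E. Wayne, *Global stability of vortex solutions of the two-dimensional
  Navier–Stokes equation*, Comm. Math. Phys. 255 (2005), App. A (spectrum of `L` in `L²(G⁻¹)`).
  [folklore]
-/

open MeasureTheory Filter Topology Set InnerProductSpace Metric
open scoped Real RealInnerProductSpace

noncomputable section

namespace Literature.Analysis.UnboundedOperators

section Poincare

variable {E : Type*} [NormedAddCommGroup E] [InnerProductSpace ℝ E] [FiniteDimensional ℝ E]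
  [MeasurableSpace E] [BorelSpace E]

/-! ### Integrable weights on `E × E` -/

/-- `G_t ⊗ G_t` is integrable on `E × E` (`0 < t`). [folklore] -/
theorem integrable_heatKernel_prod {t : ℝ} (ht : 0 < t) :
    Integrable fun p : E × E => heatKernel t p.1 * heatKernel t p.2 :=
  (integrable_heatKernel_holds ht).mul_prod (integrable_heatKernel_holds ht)

/-- The first moment `(‖x‖ + ‖y‖) G_t(x)G_t(y)` is integrable on `E × E` (`0 < t`). [folklore] -/
theorem integrable_norm_add_norm_mul_heatKernel_prod {t : ℝ} (ht : 0 < t) :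
    Integrable fun p : E × E => (‖p.1‖ + ‖p.2‖) * (heatKernel t p.1 * heatKernel t p.2) := by
  have h1 : Integrable fun p : E × E => (heatKernel t p.1 * ‖p.1‖) * heatKernel t p.2 :=
    (integrable_heatKernel_mul_norm ht).mul_prod (integrable_heatKernel_holds ht)
  have h2 : Integrable fun p : E × E => heatKernel t p.1 * (heatKernel t p.2 * ‖p.2‖) :=
    (integrable_heatKernel_holds ht).mul_prod (integrable_heatKernel_mul_norm ht)
  refine (h1.add h2).congr (Eventually.of_forall fun p => ?_)
  simp only [Pi.add_apply]
  ring

/-- A bounded continuous function times `G_t ⊗ G_t` is integrable on `E × E`. [folklore] -/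
theorem integrable_mul_heatKernel_prod {t : ℝ} (ht : 0 < t) {φ : E × E → ℝ} (hφ : Continuous φ)
    {C : ℝ} (hC : ∀ p, ‖φ p‖ ≤ C) :
    Integrable fun p : E × E => φ p * (heatKernel t p.1 * heatKernel t p.2) :=
  (integrable_heatKernel_prod ht).bdd_mul hφ.aestronglyMeasurable (Eventually.of_forall hC)

/-- A bounded continuous function times `G_t` is integrable on `E`. [folklore] -/
theorem integrable_mul_heatKernel {t : ℝ} (ht : 0 < t) {φ : E → ℝ} (hφ : Continuous φ)
    {C : ℝ} (hC : ∀ z, ‖φ z‖ ≤ C) :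
    Integrable fun z : E => φ z * heatKernel t z :=
  (integrable_heatKernel_holds ht).bdd_mul hφ.aestronglyMeasurable (Eventually.of_forall hC)

/-! ### The interpolation `X_θ = cos θ · x + sin θ · y` -/

omit [FiniteDimensional ℝ E] [MeasurableSpace E] [BorelSpace E] in
/-- `θ ↦ cos θ x + sin θ y` has derivative `−sin θ x + cos θ y`. [folklore] -/
theorem hasDerivAt_cos_smul_add_sin_smul (x y : E) (θ : ℝ) :
    HasDerivAt (fun s => Real.cos s • x + Real.sin s • y)
      (-Real.sin θ • x + Real.cos θ • y) θ := by
  have h := ((Real.hasDerivAt_cos θ).smul_const x).add ((Real.hasDerivAt_sin θ).smul_const y)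
  refine h.congr_deriv ?_
  rw [neg_smul]

omit [FiniteDimensional ℝ E] [MeasurableSpace E] [BorelSpace E] in
/-- `‖a x + b y‖ ≤ ‖x‖ + ‖y‖` for `|a|, |b| ≤ 1`. [folklore] -/
theorem norm_trig_smul_add_trig_smul_le (a b : ℝ) (ha : |a| ≤ 1) (hb : |b| ≤ 1) (x y : E) :
    ‖a • x + b • y‖ ≤ ‖x‖ + ‖y‖ := by
  calc ‖a • x + b • y‖ ≤ ‖a • x‖ + ‖b • y‖ := norm_add_le _ _
    _ = |a| * ‖x‖ + |b| * ‖y‖ := by rw [norm_smul, norm_smul, Real.norm_eq_abs, Real.norm_eq_abs]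
    _ ≤ 1 * ‖x‖ + 1 * ‖y‖ := by gcongr
    _ = ‖x‖ + ‖y‖ := by ring

variable {t : ℝ} (ht : 0 < t) {f : E → ℝ} (hf : ContDiff ℝ 1 f) {C₀ C₁ : ℝ}
  (h0 : ∀ z, ‖f z‖ ≤ C₀) (h1 : ∀ z, ‖fderiv ℝ f z‖ ≤ C₁)
include ht hf h0 h1

/-! ### The interpolation functional `F(θ) = ∬ f(x) f(cos θ x + sin θ y) G_tG_t` -/

/-- **Differentiation under the integral sign**: `F(θ) = ∬ f(x) f(cos θ x + sin θ y) G_t(x)G_t(y)`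
has derivative `∬ f(x) Df(cos θ x + sin θ y)[−sin θ x + cos θ y] G_t(x)G_t(y)`. [folklore] -/
theorem hasDerivAt_interpolation (θ₀ : ℝ) :
    HasDerivAt (fun θ => ∫ p : E × E,
        f p.1 * f (Real.cos θ • p.1 + Real.sin θ • p.2) * (heatKernel t p.1 * heatKernel t p.2))
      (∫ p : E × E, f p.1 * fderiv ℝ f (Real.cos θ₀ • p.1 + Real.sin θ₀ • p.2)
        (-Real.sin θ₀ • p.1 + Real.cos θ₀ • p.2) * (heatKernel t p.1 * heatKernel t p.2)) θ₀ := by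
  have hC₀ : 0 ≤ C₀ := (norm_nonneg _).trans (h0 0)
  have hC₁ : 0 ≤ C₁ := (norm_nonneg _).trans (h1 0)
  have hfc : Continuous f := hf.continuous
  have hfd : ∀ z, HasFDerivAt f (fderiv ℝ f z) z := fun z =>
    (hf.differentiable one_ne_zero z).hasFDerivAt
  have hf'c : Continuous (fderiv ℝ f) := hf.continuous_fderiv one_ne_zero
  have hKc : Continuous fun p : E × E => heatKernel t p.1 * heatKernel t p.2 :=
    ((continuous_heatKernel t).comp continuous_fst).mul ((continuous_heatKernel t).comp continuous_snd)
  have hrotc : ∀ θ : ℝ, Continuous fun p : E × E => Real.cos θ • p.1 + Real.sin θ • p.2 := fun θ =>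
    (continuous_fst.const_smul _).add (continuous_snd.const_smul _)
  have hrot'c : ∀ θ : ℝ, Continuous fun p : E × E => -Real.sin θ • p.1 + Real.cos θ • p.2 := fun θ =>
    (continuous_fst.const_smul _).add (continuous_snd.const_smul _)
  refine (hasDerivAt_integral_of_dominated_loc_of_deriv_le (μ := (volume : Measure (E × E)))
    (F := fun θ p => f p.1 * f (Real.cos θ • p.1 + Real.sin θ • p.2) *
      (heatKernel t p.1 * heatKernel t p.2))
    (F' := fun θ p => f p.1 * fderiv ℝ f (Real.cos θ • p.1 + Real.sin θ • p.2)
      (-Real.sin θ • p.1 + Real.cos θ • p.2) * (heatKernel t p.1 * heatKernel t p.2))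
    (bound := fun p => C₀ * C₁ * ((‖p.1‖ + ‖p.2‖) * (heatKernel t p.1 * heatKernel t p.2)))
    (x₀ := θ₀) univ_mem ?_ ?_ ?_ ?_ ?_ ?_).2
  · exact Eventually.of_forall fun θ =>
      (((hfc.comp continuous_fst).mul (hfc.comp (hrotc θ))).mul hKc).aestronglyMeasurable
  · have : (fun p : E × E => f p.1 * f (Real.cos θ₀ • p.1 + Real.sin θ₀ • p.2) *
        (heatKernel t p.1 * heatKernel t p.2)) = fun p =>
        (f p.1 * f (Real.cos θ₀ • p.1 + Real.sin θ₀ • p.2)) *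
          (heatKernel t p.1 * heatKernel t p.2) := rfl
    rw [this]
    refine integrable_mul_heatKernel_prod ht ((hfc.comp continuous_fst).mul (hfc.comp (hrotc θ₀)))
      (C := C₀ * C₀) fun p => ?_
    rw [norm_mul]
    exact mul_le_mul (h0 _) (h0 _) (norm_nonneg _) hC₀
  · exact (((hfc.comp continuous_fst).mul ((hf'c.comp (hrotc θ₀)).clm_apply (hrot'c θ₀))).mul
      hKc).aestronglyMeasurable
  · refine Eventually.of_forall fun p θ _ => ?_
    have hw : 0 ≤ heatKernel t p.1 * heatKernel t p.2 :=
      mul_nonneg (heatKernel_pos ht _).le (heatKernel_pos ht _).le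
    rw [norm_mul, norm_mul, Real.norm_of_nonneg hw]
    have hb : ‖fderiv ℝ f (Real.cos θ • p.1 + Real.sin θ • p.2) (-Real.sin θ • p.1 + Real.cos θ • p.2)‖ ≤
        C₁ * (‖p.1‖ + ‖p.2‖) :=
      (ContinuousLinearMap.le_opNorm _ _).trans (mul_le_mul (h1 _)
        (norm_trig_smul_add_trig_smul_le _ _ (by simpa using Real.abs_sin_le_one θ)
          (Real.abs_cos_le_one θ) _ _) (norm_nonneg _) hC₁)
    calc ‖f p.1‖ * ‖fderiv ℝ f (Real.cos θ • p.1 + Real.sin θ • p.2)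
          (-Real.sin θ • p.1 + Real.cos θ • p.2)‖ * (heatKernel t p.1 * heatKernel t p.2)
        ≤ C₀ * (C₁ * (‖p.1‖ + ‖p.2‖)) * (heatKernel t p.1 * heatKernel t p.2) := by
          gcongr; exact h0 _
      _ = C₀ * C₁ * ((‖p.1‖ + ‖p.2‖) * (heatKernel t p.1 * heatKernel t p.2)) := by ring
  · exact (integrable_norm_add_norm_mul_heatKernel_prod ht).const_mul _
  · refine Eventually.of_forall fun p θ _ => ?_
    exact (((hfd _).comp_hasDerivAt θ (hasDerivAt_cos_smul_add_sin_smul p.1 p.2 θ)).const_mul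
      (f p.1)).mul_const _

/-- **Rotation + Stein**: the derivative of the interpolation functional is
`F'(θ) = −2t sin θ ∬ Df(u)[∇-direction] …`, precisely
`∬ f(x) Df(X_θ)[−sin θ x + cos θ y] G_tG_t = −2t sin θ ∬ Df(cos θ u − sin θ v)[w(u)] G_tG_t`
with `w(u)` the Riesz vector of `Df(u)`, written here with the gradient. [folklore] -/
theorem integral_interpolation_deriv_eq [CompleteSpace E] (θ : ℝ) :
    ∫ p : E × E, f p.1 * fderiv ℝ f (Real.cos θ • p.1 + Real.sin θ • p.2)
        (-Real.sin θ • p.1 + Real.cos θ • p.2) * (heatKernel t p.1 * heatKernel t p.2) =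
      -(2 * t * Real.sin θ) * ∫ p : E × E,
        fderiv ℝ f (Real.cos θ • p.1 - Real.sin θ • p.2) (gradient f p.1) *
          (heatKernel t p.1 * heatKernel t p.2) := by
  have hC₀ : 0 ≤ C₀ := (norm_nonneg _).trans (h0 0)
  have hC₁ : 0 ≤ C₁ := (norm_nonneg _).trans (h1 0)
  have hfc : Continuous f := hf.continuous
  have hfdiff : Differentiable ℝ f := hf.differentiable one_ne_zero
  have hf'c : Continuous (fderiv ℝ f) := hf.continuous_fderiv one_ne_zero
  have hcs : Real.cos θ ^ 2 + Real.sin θ ^ 2 = 1 := Real.cos_sq_add_sin_sq θ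
  set c := Real.cos θ with hc
  set s := Real.sin θ with hs
  -- Step 1: rotate the variables, `(x, y) = R⁻¹(u, v)`
  have hrot := integral_comp_prodRotation_mul_heatKernel (E := E) c s hcs t
    (fun q : E × E => f (c • q.1 - s • q.2) * fderiv ℝ f q.1 q.2)
  have hsimp : ∀ p : E × E, c • (c • p.1 + s • p.2) - s • (-s • p.1 + c • p.2) = p.1 := by
    intro p
    calc c • (c • p.1 + s • p.2) - s • (-s • p.1 + c • p.2)
        = (c ^ 2 + s ^ 2) • p.1 := by module
      _ = p.1 := by rw [hcs, one_smul]
  simp only [hsimp] at hrot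
  rw [hrot]
  -- Step 2: Fubini, then Stein's identity in the inner variable `v`
  have hint : Integrable (fun q : E × E => f (c • q.1 - s • q.2) * fderiv ℝ f q.1 q.2 *
      (heatKernel t q.1 * heatKernel t q.2)) := by
    have : (fun q : E × E => f (c • q.1 - s • q.2) * fderiv ℝ f q.1 q.2 *
        (heatKernel t q.1 * heatKernel t q.2)) = fun q => (f (c • q.1 - s • q.2) * fderiv ℝ f q.1 q.2 *
          heatKernel t q.1) * heatKernel t q.2 := by funext q; ring
    rw [this]
    -- dominated by `C₀ C₁ G_t(u) · (G_t(v)‖v‖)`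
    refine ((integrable_heatKernel_holds ht).mul_prod (integrable_heatKernel_mul_norm ht)
      |>.const_mul (C₀ * C₁)).mono' ?_ (Eventually.of_forall fun q => ?_)
    · exact ((((hfc.comp ((continuous_fst.const_smul _).sub (continuous_snd.const_smul _))).mul
        ((hf'c.comp continuous_fst).clm_apply continuous_snd)).mul
        ((continuous_heatKernel t).comp continuous_fst)).mul
        ((continuous_heatKernel t).comp continuous_snd)).aestronglyMeasurable
    · have hK1 := (heatKernel_pos ht q.1).le
      have hK2 := (heatKernel_pos ht q.2).le
      rw [norm_mul, norm_mul, norm_mul, Real.norm_of_nonneg hK1, Real.norm_of_nonneg hK2]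
      calc ‖f (c • q.1 - s • q.2)‖ * ‖fderiv ℝ f q.1 q.2‖ * heatKernel t q.1 * heatKernel t q.2
          ≤ C₀ * (C₁ * ‖q.2‖) * heatKernel t q.1 * heatKernel t q.2 := by
            gcongr
            · exact h0 _
            · exact (ContinuousLinearMap.le_opNorm _ _).trans
                (mul_le_mul_of_nonneg_right (h1 _) (norm_nonneg _))
        _ = C₀ * C₁ * (heatKernel t q.1 * (heatKernel t q.2 * ‖q.2‖)) := by ring
  rw [Measure.volume_eq_prod, integral_prod _ hint]
  -- the inner integral at fixed `u`
  have hinner : ∀ u : E, ∫ v : E, f (c • u - s • v) * fderiv ℝ f u v *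
      (heatKernel t u * heatKernel t v) = heatKernel t u * (-(2 * t * s) *
        ∫ v : E, fderiv ℝ f (c • u - s • v) (gradient f u) * heatKernel t v) := by
    intro u
    -- `g(v) = f(cu − sv)` is `C¹` with `|g| ≤ C₀`, `‖Dg‖ ≤ C₁`
    have hA : ∀ v : E, HasFDerivAt (fun w : E => c • u - s • w) (-(s • ContinuousLinearMap.id ℝ E)) v :=
      fun v => by
        have := ((hasFDerivAt_id (𝕜 := ℝ) v).const_smul s).const_sub (c • u)
        simpa using this
    have hg : ContDiff ℝ 1 (fun w : E => f (c • u - s • w)) :=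
      hf.comp (contDiff_const.sub (contDiff_id.const_smul s))
    have hgd : ∀ v, HasFDerivAt (fun w : E => f (c • u - s • w))
        ((fderiv ℝ f (c • u - s • v)).comp (-(s • ContinuousLinearMap.id ℝ E))) v :=
      fun v => (hfdiff _).hasFDerivAt.comp v (hA v)
    have hg1 : ∀ v, ‖fderiv ℝ (fun w : E => f (c • u - s • w)) v‖ ≤ C₁ := by
      intro v
      rw [(hgd v).fderiv]
      refine (ContinuousLinearMap.opNorm_comp_le _ _).trans ?_
      rw [norm_neg, norm_smul, Real.norm_eq_abs]
      calc ‖fderiv ℝ f (c • u - s • v)‖ * (|s| * ‖ContinuousLinearMap.id ℝ E‖)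
          ≤ C₁ * (1 * 1) := by
            gcongr
            · exact h1 _
            · exact hs ▸ Real.abs_sin_le_one θ
            · exact ContinuousLinearMap.norm_id_le
        _ = C₁ := by ring
    have hstein := integral_inner_mul_mul_heatKernel ht hg (fun v => h0 _) hg1 (gradient f u)
    -- rewrite `Df(u)[v] = ⟪v, ∇f(u)⟫` and pull out `G_t(u)`
    have hlhs : (fun v => f (c • u - s • v) * fderiv ℝ f u v * (heatKernel t u * heatKernel t v)) =
        fun v => heatKernel t u * (⟪v, gradient f u⟫ * f (c • u - s • v) * heatKernel t v) := by
      funext v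
      rw [real_inner_comm, gradient, InnerProductSpace.toDual_symm_apply]
      ring
    rw [hlhs, integral_const_mul, hstein]
    congr 1
    have hD : (fun z => fderiv ℝ (fun w : E => f (c • u - s • w)) z (gradient f u) *
        heatKernel t z) = fun z => -s * (fderiv ℝ f (c • u - s • z) (gradient f u) *
          heatKernel t z) := by
      funext z
      rw [(hgd z).fderiv]
      simp
      ring
    rw [hD, integral_const_mul]
    ring
  simp_rw [hinner]
  -- Step 3: Fubini back
  have hgc : Continuous (gradient f) := (InnerProductSpace.toDual ℝ E).symm.continuous.comp hf'c
  have hgb : ∀ u, ‖gradient f u‖ ≤ C₁ := fun u => by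
    rw [gradient, LinearIsometryEquiv.norm_map]; exact h1 u
  have hint2 : Integrable (fun q : E × E => fderiv ℝ f (c • q.1 - s • q.2) (gradient f q.1) *
      (heatKernel t q.1 * heatKernel t q.2)) := by
    refine integrable_mul_heatKernel_prod ht ((hf'c.comp ((continuous_fst.const_smul _).sub
      (continuous_snd.const_smul _))).clm_apply (hgc.comp continuous_fst)) (C := C₁ * C₁)
      fun q => ?_
    exact (ContinuousLinearMap.le_opNorm _ _).trans (mul_le_mul (h1 _) (hgb _) (norm_nonneg _) hC₁)
  rw [integral_prod _ hint2]
  conv_rhs => rw [← integral_const_mul]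
  congr 1
  funext u
  have hu : (fun v : E => fderiv ℝ f (c • (u, v).1 - s • (u, v).2) (gradient f (u, v).1) *
      (heatKernel t (u, v).1 * heatKernel t (u, v).2)) = fun v =>
      heatKernel t u * (fderiv ℝ f (c • u - s • v) (gradient f u) * heatKernel t v) := by
    funext v
    simp only
    ring
  rw [hu, integral_const_mul]
  ring

omit h0 in
/-- The correlation term is bounded by the Dirichlet energy:
`∬ Df(cos θ u − sin θ v)[∇f(u)] G_tG_t ≤ ∫ ‖Df‖² G_t` (`2ab ≤ a² + b²` and the Gaussian
stability `cos θ U − sin θ V ∼ U`). [folklore] -/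
theorem integral_interpolation_corr_le [CompleteSpace E] (θ : ℝ) :
    ∫ p : E × E, fderiv ℝ f (Real.cos θ • p.1 - Real.sin θ • p.2) (gradient f p.1) *
        (heatKernel t p.1 * heatKernel t p.2) ≤ ∫ z, ‖fderiv ℝ f z‖ ^ 2 * heatKernel t z := by
  have hC₁ : 0 ≤ C₁ := (norm_nonneg _).trans (h1 0)
  have hf'c : Continuous (fderiv ℝ f) := hf.continuous_fderiv one_ne_zero
  have hgc : Continuous (gradient f) := (InnerProductSpace.toDual ℝ E).symm.continuous.comp hf'c
  have hgn : ∀ u, ‖gradient f u‖ = ‖fderiv ℝ f u‖ := fun u => by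
    rw [gradient, LinearIsometryEquiv.norm_map]
  have hgb : ∀ u, ‖gradient f u‖ ≤ C₁ := fun u => by rw [hgn]; exact h1 u
  have hcs : Real.cos θ ^ 2 + (-Real.sin θ) ^ 2 = 1 := by
    rw [neg_sq]; exact Real.cos_sq_add_sin_sq θ
  set c := Real.cos θ with hc
  set s := Real.sin θ with hs
  have hrotc : Continuous fun p : E × E => c • p.1 - s • p.2 :=
    (continuous_fst.const_smul _).sub (continuous_snd.const_smul _)
  -- pointwise `Df(z)[∇f u] ≤ ½ (‖Df z‖² + ‖Df u‖²)`
  have hpt : ∀ p : E × E, fderiv ℝ f (c • p.1 - s • p.2) (gradient f p.1) *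
      (heatKernel t p.1 * heatKernel t p.2) ≤
      (1 / 2 * ‖fderiv ℝ f (c • p.1 + (-s) • p.2)‖ ^ 2 + 1 / 2 * ‖fderiv ℝ f p.1‖ ^ 2) *
        (heatKernel t p.1 * heatKernel t p.2) := by
    intro p
    have hw : 0 ≤ heatKernel t p.1 * heatKernel t p.2 :=
      mul_nonneg (heatKernel_pos ht _).le (heatKernel_pos ht _).le
    refine mul_le_mul_of_nonneg_right ?_ hw
    rw [neg_smul, ← sub_eq_add_neg]
    have hle : fderiv ℝ f (c • p.1 - s • p.2) (gradient f p.1) ≤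
        ‖fderiv ℝ f (c • p.1 - s • p.2)‖ * ‖fderiv ℝ f p.1‖ :=
      (le_abs_self _).trans ((Real.norm_eq_abs _).symm.le.trans
        ((ContinuousLinearMap.le_opNorm _ _).trans (by rw [hgn])))
    nlinarith [sq_nonneg (‖fderiv ℝ f (c • p.1 - s • p.2)‖ - ‖fderiv ℝ f p.1‖)]
  -- integrate
  have hi1 : Integrable fun p : E × E => fderiv ℝ f (c • p.1 - s • p.2) (gradient f p.1) *
      (heatKernel t p.1 * heatKernel t p.2) :=
    integrable_mul_heatKernel_prod ht ((hf'c.comp hrotc).clm_apply (hgc.comp continuous_fst))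
      (C := C₁ * C₁) fun q =>
      (ContinuousLinearMap.le_opNorm _ _).trans (mul_le_mul (h1 _) (hgb _) (norm_nonneg _) hC₁)
  have hφc : Continuous fun z : E => ‖fderiv ℝ f z‖ ^ 2 := (hf'c.norm).pow 2
  have hφb : ∀ z : E, ‖‖fderiv ℝ f z‖ ^ 2‖ ≤ C₁ ^ 2 := fun z => by
    rw [Real.norm_of_nonneg (sq_nonneg _)]
    exact pow_le_pow_left₀ (norm_nonneg _) (h1 z) 2
  have hi2 : Integrable fun p : E × E => ‖fderiv ℝ f (c • p.1 + (-s) • p.2)‖ ^ 2 *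
      (heatKernel t p.1 * heatKernel t p.2) :=
    integrable_mul_heatKernel_prod ht (hφc.comp ((continuous_fst.const_smul _).add
      (continuous_snd.const_smul _))) (C := C₁ ^ 2) fun q => hφb _
  have hi3 : Integrable fun p : E × E => ‖fderiv ℝ f p.1‖ ^ 2 *
      (heatKernel t p.1 * heatKernel t p.2) :=
    integrable_mul_heatKernel_prod ht (hφc.comp continuous_fst) (C := C₁ ^ 2) fun q => hφb _
  have hA1 := integral_comp_prodRotation_fst_mul_heatKernel (E := E) c (-s) hcs ht
    (fun z => ‖fderiv ℝ f z‖ ^ 2)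
  have hA2 := integral_comp_prodRotation_fst_mul_heatKernel (E := E) 1 0 (by norm_num) ht
    (fun z => ‖fderiv ℝ f z‖ ^ 2)
  simp only [one_smul, zero_smul, add_zero] at hA2
  calc ∫ p : E × E, fderiv ℝ f (c • p.1 - s • p.2) (gradient f p.1) *
        (heatKernel t p.1 * heatKernel t p.2)
      ≤ ∫ p : E × E, (1 / 2 * ‖fderiv ℝ f (c • p.1 + (-s) • p.2)‖ ^ 2 +
          1 / 2 * ‖fderiv ℝ f p.1‖ ^ 2) * (heatKernel t p.1 * heatKernel t p.2) :=
        integral_mono hi1 (((hi2.const_mul (1 / 2)).add (hi3.const_mul (1 / 2))).congr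
          (Eventually.of_forall fun p => by simp only [Pi.add_apply]; ring)) hpt
    _ = ∫ p : E × E, (1 / 2 * (‖fderiv ℝ f (c • p.1 + (-s) • p.2)‖ ^ 2 *
          (heatKernel t p.1 * heatKernel t p.2)) +
        1 / 2 * (‖fderiv ℝ f p.1‖ ^ 2 * (heatKernel t p.1 * heatKernel t p.2))) := by
        congr 1; funext p; ring
    _ = 1 / 2 * (∫ p : E × E, ‖fderiv ℝ f (c • p.1 + (-s) • p.2)‖ ^ 2 *
          (heatKernel t p.1 * heatKernel t p.2)) +
        1 / 2 * (∫ p : E × E, ‖fderiv ℝ f p.1‖ ^ 2 * (heatKernel t p.1 * heatKernel t p.2)) := by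
        rw [integral_add (hi2.const_mul _) (hi3.const_mul _), integral_const_mul,
          integral_const_mul]
    _ = ∫ z, ‖fderiv ℝ f z‖ ^ 2 * heatKernel t z := by rw [hA1, hA2]; ring

/-- **The Gaussian Poincaré inequality for the heat-kernel measure** (sharp constant): for
`f ∈ C¹(E)` with `f` and `Df` bounded and `0 < t`,
`∫ f² G_t − (∫ f G_t)² ≤ 2t ∫ ‖Df‖² G_t`. For `t = 1` on `ℝ²` (`G_1 = G` the Gaussian vortex)
this is the spectral-gap estimate `−⟨Lw,w⟩ ≥ ½‖w‖²` of `L = Δ + ½x·∇ + 1` in `L²(G⁻¹dx)` on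
mean-zero functions (Gallay–Wayne, App. A). [folklore] -/
theorem sq_integral_heatKernel_poincare :
    (∫ z, f z ^ 2 * heatKernel t z) - (∫ z, f z * heatKernel t z) ^ 2 ≤
      2 * t * ∫ z, ‖fderiv ℝ f z‖ ^ 2 * heatKernel t z := by
  haveI : CompleteSpace E := FiniteDimensional.complete ℝ E
  set A : ℝ := ∫ z, ‖fderiv ℝ f z‖ ^ 2 * heatKernel t z with hA_def
  set F : ℝ → ℝ := fun θ => ∫ p : E × E,
    f p.1 * f (Real.cos θ • p.1 + Real.sin θ • p.2) * (heatKernel t p.1 * heatKernel t p.2)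
    with hF_def
  -- the endpoints
  have hF0 : F 0 = ∫ z, f z ^ 2 * heatKernel t z := by
    simp only [hF_def, Real.cos_zero, Real.sin_zero, one_smul, zero_smul, add_zero]
    have := integral_prod_mul (μ := (volume : Measure E)) (ν := (volume : Measure E))
      (fun x => f x ^ 2 * heatKernel t x) (heatKernel t)
    rw [integral_heatKernel_eq_one_holds ht, mul_one] at this
    rw [← this]
    congr 1; funext p; ring
  have hFpi : F (π / 2) = (∫ z, f z * heatKernel t z) ^ 2 := by
    simp only [hF_def, Real.cos_pi_div_two, Real.sin_pi_div_two, one_smul, zero_smul, zero_add]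
    have := integral_prod_mul (μ := (volume : Measure E)) (ν := (volume : Measure E))
      (fun x => f x * heatKernel t x) (fun y => f y * heatKernel t y)
    rw [← pow_two] at this
    rw [← this]
    congr 1; funext p; ring
  -- the derivative and its lower bound
  have hderiv : ∀ θ, HasDerivAt F (-(2 * t * Real.sin θ) * ∫ p : E × E,
      fderiv ℝ f (Real.cos θ • p.1 - Real.sin θ • p.2) (gradient f p.1) *
        (heatKernel t p.1 * heatKernel t p.2)) θ := fun θ => by
    have h := hasDerivAt_interpolation ht hf h0 h1 θ
    rw [integral_interpolation_deriv_eq ht hf h0 h1 θ] at h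
    exact h
  have hmono : MonotoneOn (fun θ => F θ - 2 * t * A * Real.cos θ) (Icc 0 (π / 2)) := by
    have hd : ∀ θ, HasDerivAt (fun θ => F θ - 2 * t * A * Real.cos θ)
        (-(2 * t * Real.sin θ) * (∫ p : E × E,
          fderiv ℝ f (Real.cos θ • p.1 - Real.sin θ • p.2) (gradient f p.1) *
            (heatKernel t p.1 * heatKernel t p.2)) - 2 * t * A * -Real.sin θ) θ := fun θ =>
      (hderiv θ).sub ((Real.hasDerivAt_cos θ).const_mul _)
    refine monotoneOn_of_hasDerivWithinAt_nonneg (convex_Icc _ _)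
      (fun θ _ => (hd θ).continuousAt.continuousWithinAt)
      (fun θ _ => (hd θ).hasDerivWithinAt) fun θ hθ => ?_
    rw [interior_Icc] at hθ
    have hsin : 0 ≤ Real.sin θ :=
      Real.sin_nonneg_of_nonneg_of_le_pi hθ.1.le (by linarith [hθ.2, Real.pi_pos])
    have hcorr := integral_interpolation_corr_le ht hf h1 θ
    have h2t : 0 ≤ 2 * t * Real.sin θ := by positivity
    nlinarith [mul_le_mul_of_nonneg_left hcorr h2t]
  have hkey := hmono (left_mem_Icc.2 (by positivity)) (right_mem_Icc.2 (by positivity))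
    (by positivity : (0 : ℝ) ≤ π / 2)
  simp only [Real.cos_zero, Real.cos_pi_div_two, mul_one, mul_zero, sub_zero] at hkey
  have hkey' : F 0 - F (π / 2) ≤ 2 * t * A := by linarith
  rwa [hF0, hFpi] at hkey'

end Poincare

end Literature.Analysis.UnboundedOperators
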